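import Literature.Barriers.PneNP.TSPExtensionComplexityGadgetXor
import Mathlib.Data.Finset.Prod
import Mathlib.Tactic.Linarith
import HarnessLib

/-!
# The TSP gadget graph: the valid inequalities with unique-disjointness slack

Support file for the discharge of `Literature.Barriers.PneNP.TSPExtensionComplexity` (FMPTW
2015, Thm. 12). With the bits `B_i(T) :↔ ge i ∉ T` (`ge i` = first edge of the chain of `i`)
and the pair indicators `Y_{ij}(T) :↔ rpe (i,j) ∉ T` (`rpe` = the plain triangle edge `{R,P}`
of the pair) of a tour `T` of the complete graph on `GV n pad`, the previous file gives
`B_i ∧ B_j → Y_{ij}` for tours inside the gadget graph (`not_rp_of_bits`). Hence, for every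
`a ⊆ [n]`, writing `k = #{i ∈ a : B_i}`,
`#{(i,j) ∈ a.offDiag : rpe (i,j) ∈ T} - #{i ∈ a : ge i ∈ T} ≤ (|a|(|a|-1) - k(k-1)) - (|a| - k)`
`= |a.offDiag| - |a| + 1 - (k-1)² ≤ |a.offDiag| - |a| + 1`,
and tours NOT inside the gadget graph satisfy the same bound once `n²` is subtracted for each
foreign edge (`tour_ineq`). This is FMPTW's Lemma 6 inequality
`⟨2 diag(a) - aaᵀ, x⟩ ≤ 1` read through the gadget graph (slack `(1 - |a ∩ b|)²` on the
designated tours, next file), in the counting form that the LP assembly turns into a linear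
functional of the edge vector. All proved; [folklore] mechanism, [cite: FioriniEtAl2015, Lemma 6] for the inequality.
-/

namespace Literature.Barriers.PneNP

open GV Finset

variable {n pad : ℕ}

/-- The first edge `{s₀(i,0), g i false}` of the chain of bit `i`; the tour's bit `B_i` is
"this edge is NOT used". [folklore] -/
def ge (i : Fin n) : Sym2 (GV n pad) := s(x i ⟨0, i.pos⟩ 2 0, g i false)

/-- The plain triangle edge `{R, P} = {a i j 2, a i j 0}` of the pair `{i, j}` (`i < j`),
addressed by either ordered pair. [folklore] -/
def rpe (p : Fin n × Fin n) : Sym2 (GV n pad) :=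
  if p.1 < p.2 then s(a p.1 p.2 2, a p.1 p.2 0) else s(a p.2 p.1 2, a p.2 p.1 0)

/-- `rpe` is symmetric in the ordered pair. [folklore] -/
theorem rpe_swap (i j : Fin n) (hij : i ≠ j) : (rpe (i, j) : Sym2 (GV n pad)) = rpe (j, i) := by
  unfold rpe
  rcases lt_or_gt_of_ne hij with h | h
  · simp [h, not_lt.2 h.le]
  · simp [h, not_lt.2 h.le]

/-- For bits `i ≠ j` both set, the pair's plain edge is unused (either orientation).
[folklore] -/
theorem rpe_not_mem_of_bits {T : Finset (Sym2 (GV n pad))} (hT : IsTourOn T)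
    (hTG : ∀ e ∈ T, e ∈ (gadgetGraph n pad).edgeSet) {i j : Fin n} (hij : i ≠ j)
    (hBi : ge i ∉ T) (hBj : ge j ∉ T) : rpe (i, j) ∉ T := by
  unfold rpe
  rcases lt_or_gt_of_ne hij with h | h
  · simp only [h, if_true]
    exact not_rp_of_bits hT hTG i j h hBi hBj
  · simp only [not_lt.2 h.le, if_false]
    exact not_rp_of_bits hT hTG j i h hBj hBi

/-- **The counting inequality for tours inside the gadget graph.** For `a ⊆ [n]`:
`#{p ∈ a.offDiag : rpe p ∈ T} + #{i ∈ a : ge i ∉ T}·… ` precisely,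
`#{p ∈ a.offDiag : rpe p ∈ T} - #{i ∈ a : ge i ∈ T} ≤ |a.offDiag| - |a| + 1` over `ℤ`.
[cite: FioriniEtAl2015, Lemma 6 (PDF p. 9)] -/
theorem tour_ineq_supported {T : Finset (Sym2 (GV n pad))} (hT : IsTourOn T)
    (hTG : ∀ e ∈ T, e ∈ (gadgetGraph n pad).edgeSet) (a : Finset (Fin n)) :
    ((a.offDiag.filter fun p => rpe p ∈ T).card : ℤ) - ((a.filter fun i => ge i ∈ T).card : ℤ)
      ≤ (a.offDiag.card : ℤ) - a.card + 1 := by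
  classical
  set B := a.filter fun i => ge i ∉ T with hB
  -- pairs of set bits avoid the plain edge
  have hsub : (a.offDiag.filter fun p => rpe p ∈ T) ⊆ a.offDiag \ B.offDiag := by
    intro p hp
    rw [mem_filter] at hp
    rw [mem_sdiff]
    refine ⟨hp.1, fun hpB => ?_⟩
    rw [mem_offDiag] at hpB
    obtain ⟨h1, h2, h12⟩ := hpB
    rw [hB, mem_filter] at h1 h2
    exact rpe_not_mem_of_bits hT hTG h12 h1.2 h2.2 hp.2
  have hBoff : B.offDiag ⊆ a.offDiag := offDiag_mono (filter_subset _ a)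
  have h1 : (a.offDiag.filter fun p => rpe p ∈ T).card + B.offDiag.card ≤ a.offDiag.card := by
    have := card_le_card hsub
    rw [card_sdiff_of_subset hBoff] at this
    have := card_le_card hBoff
    omega
  -- bits split `a`
  have h2 : (a.filter fun i => ge i ∈ T).card + B.card = a.card := by
    rw [hB]
    convert card_filter_add_card_filter_not (s := a) (fun i => ge i ∈ T) using 3
  have h3 : B.offDiag.card = B.card * B.card - B.card := offDiag_card B
  -- arithmetic: with k = |B|, LHS ≤ (|offDiag| - (k² - k)) - (|a| - k) = RHS - (k-1)²
  have hk : B.card ≤ B.card * B.card := Nat.le_mul_self _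
  have e1 : ((a.offDiag.filter fun p => rpe p ∈ T).card : ℤ) +
      ((B.card : ℤ) * B.card - B.card) ≤ a.offDiag.card := by
    have h1' : (((a.offDiag.filter fun p => rpe p ∈ T).card +
        (B.card * B.card - B.card) : ℕ) : ℤ) ≤ a.offDiag.card := by
      rw [← h3]; exact_mod_cast h1
    push_cast [Nat.cast_sub hk] at h1'
    linarith
  have e2 : ((a.filter fun i => ge i ∈ T).card : ℤ) = a.card - B.card := by
    have := h2; omega
  rw [e2]
  nlinarith [e1, sq_nonneg ((B.card : ℤ) - 1)]

/-- **The inequality for ALL tours of the complete graph on `GV n pad`**, with the penalty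
`n²` per edge outside the gadget graph (those tours never beat the bound since
`|a| ≤ n ≤ n²`). [cite: FioriniEtAl2015, Lemma 6 (PDF p. 9)] -/
theorem tour_ineq {T : Finset (Sym2 (GV n pad))} (hT : IsTourOn T) (a : Finset (Fin n)) :
    ((a.offDiag.filter fun p => rpe p ∈ T).card : ℤ) - ((a.filter fun i => ge i ∈ T).card : ℤ)
      - (n : ℤ) ^ 2 * ((T.filter fun e => e ∉ (gadgetGraph n pad).edgeSet).card : ℤ)
      ≤ (a.offDiag.card : ℤ) - a.card + 1 := by
  classical
  by_cases hTG : ∀ e ∈ T, e ∈ (gadgetGraph n pad).edgeSet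
  · have h0 : (T.filter fun e => e ∉ (gadgetGraph n pad).edgeSet).card = 0 := by
      rw [card_eq_zero, filter_eq_empty_iff]
      exact fun e he h => h (hTG e he)
    rw [h0]
    simpa using tour_ineq_supported hT hTG a
  · push Not at hTG
    obtain ⟨e₀, he₀, he₀G⟩ := hTG
    have hpen : 1 ≤ (T.filter fun e => e ∉ (gadgetGraph n pad).edgeSet).card :=
      card_pos.2 ⟨e₀, mem_filter.2 ⟨he₀, he₀G⟩⟩
    have hf : (a.offDiag.filter fun p => rpe p ∈ T).card ≤ a.offDiag.card :=
      card_le_card (filter_subset _ _)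
    have ha : a.card ≤ n := by simpa using card_le_univ a
    have hn : (n : ℤ) ≤ (n : ℤ) ^ 2 := by nlinarith
    have hpen' : (1 : ℤ) ≤ ((T.filter fun e => e ∉ (gadgetGraph n pad).edgeSet).card : ℤ) := by
      exact_mod_cast hpen
    have hge0 : (0 : ℤ) ≤ ((a.filter fun i => ge i ∈ T).card : ℤ) := by positivity
    nlinarith

end Literature.Barriers.PneNP
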